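import Summits.Parity.BatemanHorn.Theorems.AlmostPrimeZerosSystemZeroRepulsionApHolRieszBound
import HarnessLib

/-!
# Crux `DiscMajorantLog` (stmt-Parity-17114,
`Summit.Parity.BatemanHorn.Theses.AlmostPrimeZeros.DiscMajorantLog`), line `Sketch`:
stub `stub_apHolRieszBoundThinWide` — the pole-free Riesz engine on a THIN region, WIDE radius

For `f = aX + b` (`a ≥ 2`) the non-principal characters mod `a` contribute Dirichlet series
`F(s) = Σ a(n) n^{-s}` that are HOLOMORPHIC (no pole, no branch point) on a classical region
`zfr (c/(R+1)) = {σ > 1 − (c/(R+1))/log(|t|+4)}` with `‖F(s)‖ ≤ B (K log(|t|+4))^R`.  This file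
turns that into the negligibility of the Riesz mean `A₁(x) = Σ_{n ≤ x} a(n)(x − n)`:
`‖A₁(x)‖ ≤ x² (log x)^{−R} e^{−(log log x)³} B` for `x ≥ X₀(c, K)`, uniformly in
`1 ≤ R ≤ 4 log log x + 4`, `B ≥ 0`, `a`, `F` (the registered stub `stub_apHolRieszBoundThinWide`).
It is the variant of the landed `stub_apHolRieszBound` (region `zfr c`, range `R ≤ log log x`) at
the crux's constants.  Route (Landau; Montgomery–Vaughan §7.4 p. 178 without the keyhole): the
landed fixed-parameter contour estimate `stub_apHolRieszBoundCore` at `σ₀ = 1 + 1/L`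
(`L = log x = e^ℓ`), `T = exp(3ℓ³)`, `σ₁ = 1 − c'/log(T+4)`, `c' = min(c,1)/(2(R+1))`, and
elementary `exp`/`log` bookkeeping: with `Λ = log(K log(T+4)) ≤ log K + 2 + 3ℓ` and
`R ≤ 4ℓ + 4` the three pieces are `≤ x² B e^{−Rℓ−ℓ³}` (tails: `1 + 2Rℓ ≤ 2ℓ³`),
`≤ x² B e^{−Rℓ−ℓ³}/8` (left side: `ΛR + Rℓ + ℓ³ + 3 ≤ 5ℓ³ ≤ L·c'/log(T+4)`, from
`(200/min(c,1)) ℓ⁷ ≤ e^ℓ`) and `≤ x² B e^{−Rℓ−ℓ³}` (horizontal sides, `T² = e^{6ℓ³}`), once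
`ℓ ≥ ℓ₀(c, K)` (`ApHolThinWide.eventually_master`).
Everything here is PROVED.

## References

* [MontgomeryVaughan2007] H. L. Montgomery, R. C. Vaughan, *Multiplicative Number Theory I*,
  CUP 2007, §7.4, proof of Theorem 7.17 (pp. 177–178); §6.2 Theorem 6.9.
* [LandauMathAnn1903] E. Landau, *Neuer Beweis des Primzahlsatzes und Beweis des
  Primidealsatzes*, Math. Ann. 56 (1903), 645–670, §§5–7.
-/

noncomputable section

open Filter
open scoped Real
open Summit.Parity.BatemanHorn.Cruxes.LinearCappedRepulsion.JensenStieltjesMajorant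
open Summit.Parity.BatemanHorn.Cruxes.SystemZeroRepulsion.NearFar

namespace Summit.Parity.BatemanHorn.Cruxes.DiscMajorantLog.Sketch

namespace ApHolThinWide

/-- **The eventual conditions on `ℓ = log log x`**: for constants `A`, `K'`, eventually `ℓ ≥ 6`,
`ℓ ≥ A` and `K' ℓ⁷ ≤ e^ℓ`. [folklore] -/
theorem eventually_master (A K' : ℝ) :
    ∀ᶠ ℓ : ℝ in atTop, 6 ≤ ℓ ∧ A ≤ ℓ ∧ K' * ℓ ^ 7 ≤ Real.exp ℓ := by
  have h1 : ∀ᶠ ℓ : ℝ in atTop, 6 ≤ ℓ := eventually_ge_atTop 6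
  have h2 : ∀ᶠ ℓ : ℝ in atTop, A ≤ ℓ := eventually_ge_atTop A
  have h3 : ∀ᶠ ℓ : ℝ in atTop, K' * ℓ ^ 7 ≤ Real.exp ℓ := by
    have ht := Real.tendsto_pow_mul_exp_neg_atTop_nhds_zero 7
    have hK : (0 : ℝ) < 1 / (|K'| + 1) := by positivity
    have hev := (tendsto_order.1 ht).2 _ hK
    filter_upwards [hev, eventually_ge_atTop (0 : ℝ)] with ℓ hℓ hℓ0
    have hℓ' : ℓ ^ 7 * Real.exp (-ℓ) < 1 / (|K'| + 1) := hℓ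
    have hpos : 0 < Real.exp ℓ := Real.exp_pos ℓ
    have e' : Real.exp (-ℓ) * Real.exp ℓ = 1 := by rw [← Real.exp_add]; simp
    have h7 : 0 ≤ ℓ ^ 7 := pow_nonneg hℓ0 7
    calc K' * ℓ ^ 7 ≤ |K'| * ℓ ^ 7 := mul_le_mul_of_nonneg_right (le_abs_self K') h7
      _ = |K'| * (ℓ ^ 7 * Real.exp (-ℓ)) * Real.exp ℓ := by rw [mul_assoc, mul_assoc, e', mul_one]
      _ ≤ |K'| * (1 / (|K'| + 1)) * Real.exp ℓ := by gcongr
      _ ≤ 1 * Real.exp ℓ := by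
          refine mul_le_mul_of_nonneg_right ?_ hpos.le
          rw [mul_one_div, div_le_one (by positivity)]; linarith
      _ = Real.exp ℓ := one_mul _
  filter_upwards [h1, h2, h3] with ℓ a b c using ⟨a, b, c⟩

/-- **The polynomial inequalities in `ℓ ≥ 6`** behind the three pieces, for `0 ≤ R ≤ 4ℓ + 4`,
`Λ ≤ C + 2 + 3ℓ`, `0 ≤ C ≤ ℓ − 2`: `1 + 2Rℓ ≤ 2ℓ³` and `ΛR + Rℓ + ℓ³ + 3 ≤ 5ℓ³`. [folklore] -/
theorem key {ℓ R Λ C : ℝ} (hℓ6 : 6 ≤ ℓ) (hC : 0 ≤ C) (hCℓ : C + 2 ≤ ℓ) (hR0 : 0 ≤ R)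
    (hR4 : R ≤ 4 * ℓ + 4) (hΛ : Λ ≤ C + 2 + 3 * ℓ) :
    1 + 2 * (R * ℓ) ≤ 2 * ℓ ^ 3 ∧ Λ * R + R * ℓ + ℓ ^ 3 + 3 ≤ 5 * ℓ ^ 3 := by
  have hℓ0 : 0 < ℓ := by linarith
  have hsq : 6 * ℓ ≤ ℓ ^ 2 := by rw [sq]; exact mul_le_mul_of_nonneg_right hℓ6 hℓ0.le
  have hcu : 6 * ℓ ^ 2 ≤ ℓ ^ 3 := by
    rw [pow_succ' ℓ 2]; exact mul_le_mul_of_nonneg_right hℓ6 (sq_nonneg ℓ)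
  have hRℓ : R * ℓ ≤ (4 * ℓ + 4) * ℓ := mul_le_mul_of_nonneg_right hR4 hℓ0.le
  have hΛR : Λ * R ≤ (C + 2 + 3 * ℓ) * R := mul_le_mul_of_nonneg_right hΛ hR0
  have hCR : (C + 2 + 4 * ℓ) * R ≤ (C + 2 + 4 * ℓ) * (4 * ℓ + 4) :=
    mul_le_mul_of_nonneg_left hR4 (by linarith)
  have hC4 : (C + 2) * (4 * ℓ + 4) ≤ ℓ * (4 * ℓ + 4) :=
    mul_le_mul_of_nonneg_right hCℓ (by linarith)
  exact ⟨by linarith, by linarith⟩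

/-- `log (K M) ≤ log K + 2 + 3ℓ` for `K ≥ 1`, `1 ≤ M ≤ 4ℓ³`, `ℓ ≥ 1` (`log 4 ≤ 2`, `log ℓ ≤ ℓ`).
[folklore] -/
theorem log_factor_le {K ℓ M : ℝ} (hK : 1 ≤ K) (hℓ1 : 1 ≤ ℓ) (hM1 : 1 ≤ M)
    (hM : M ≤ 4 * ℓ ^ 3) : Real.log (K * M) ≤ Real.log K + 2 + 3 * ℓ := by
  have hℓ0 : 0 < ℓ := by linarith
  rw [Real.log_mul (by positivity) (by positivity)]
  have h4 : Real.log 4 ≤ 2 := by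
    have e : Real.log 4 = 2 * Real.log 2 := by
      rw [show (4 : ℝ) = 2 ^ 2 by norm_num, Real.log_pow]; push_cast; ring
    rw [e]; linarith [RieszDiff.numerics.2.2]
  have hlogℓ : Real.log ℓ ≤ ℓ := (Real.log_le_sub_one_of_pos hℓ0).trans (by linarith)
  have hM' : Real.log M ≤ Real.log 4 + 3 * Real.log ℓ := by
    calc Real.log M ≤ Real.log (4 * ℓ ^ 3) := Real.log_le_log (by positivity) hM
      _ = Real.log 4 + 3 * Real.log ℓ := by
          rw [Real.log_mul (by norm_num) (by positivity), Real.log_pow]; push_cast; ring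
  linarith

end ApHolThinWide

open ApHolThinWide in
/-- **Stub (`stub_apHolRieszBoundThinWide`): the pole-free Riesz engine on a THIN region, WIDE
radius.**  For `c > 0`, `K ≥ 1` there is `X₀ = X₀(c, K)` such that for all `R ≥ 1`, `B ≥ 0`,
coefficients `a` and `F` holomorphic on `zfr (c/(R+1))` with `‖F(s)‖ ≤ B (K log(|t|+4))^R` there,
`Σ a(n) n^{-s} = F(s)` (`σ > 1`, absolutely convergent) and `Σ ‖a(n)‖ n^{-σ} ≤ B (σ−1)^{−R}`
(`1 < σ ≤ 2`): for `x ≥ X₀` with `R ≤ 4 log log x + 4`,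
`‖Σ_{n ≤ x} a(n)(x − n)‖ ≤ x² (log x)^{−R} e^{−(log log x)³} B`.
Proof: `stub_apHolRieszBoundCore` (region `zfr (c/(R+1))`) at `σ₀ = 1 + 1/L` (`L = log x = e^ℓ`),
`T = exp(3ℓ³)`, `σ₁ = 1 − δ`, `δ = c'/log(T+4)`, `c' = min(c,1)/(2(R+1)) < c/(R+1)`; then
`x^{1+σ₀} = e x²`, `x^{1+σ₁} = x² e^{−Lδ}`, `Σ‖a(n)‖n^{−σ₀} ≤ B e^{Rℓ}`, `(K log(T+4))^R = e^{ΛR}`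
with `Λ ≤ log K + 2 + 3ℓ` (`log(T+4) ≤ 4ℓ³`), `Lδ ≥ 5ℓ³` (from `(200/min(c,1)) ℓ⁷ ≤ e^ℓ = L`,
`R + 1 ≤ 5ℓ`), and the polynomial inequalities of `ApHolThinWide.key`; finally `1/(2π) ≤ 1/6`,
`π ≤ 4`. [cite: MontgomeryVaughan2007, §7.4 pp. 177–178] -/
theorem stub_apHolRieszBoundThinWide :
    ∀ (c K : ℝ), 0 < c → 1 ≤ K → ∃ X₀ : ℝ, ∀ (R B : ℝ) (a : ℕ → ℂ) (F : ℂ → ℂ), 1 ≤ R → 0 ≤ B →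
      DifferentiableOn ℂ F (Literature.NumberTheory.LFunctions.ClassicalPsiData.zfr (c / (R + 1))) →
      (∀ s ∈ Literature.NumberTheory.LFunctions.ClassicalPsiData.zfr (c / (R + 1)),
        ‖F s‖ ≤ B * (K * Real.log (|s.im| + 4)) ^ R) →
      (∀ σ : ℝ, 1 < σ → LSeriesSummable a σ) →
      (∀ s : ℂ, 1 < s.re → LSeries a s = F s) →
      (∀ σ : ℝ, 1 < σ → σ ≤ 2 → ∑' n : ℕ, ‖LSeries.term a σ n‖ ≤ B / (σ - 1) ^ R) →
      ∀ x : ℝ, X₀ ≤ x → R ≤ 4 * Real.log (Real.log x) + 4 →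
        ‖∑ n ∈ Finset.Ioc 0 ⌊x⌋₊, a n * ((x : ℂ) - n)‖ ≤
          x ^ 2 * Real.log x ^ (-R) * Real.exp (-(Real.log (Real.log x)) ^ 3) * B := by
  intro c K hc hK
  have hK0 : 0 < K := by linarith
  -- the constants `c₁ = min(c,1)`, `C = log K`, and `ℓ₀`
  obtain ⟨c₁, hc₁def⟩ : ∃ c₁ : ℝ, c₁ = min c 1 := ⟨_, rfl⟩
  have hc₁0 : 0 < c₁ := by rw [hc₁def]; exact lt_min hc one_pos
  have hc₁c : c₁ ≤ c := by rw [hc₁def]; exact min_le_left c 1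
  have hc₁1 : c₁ ≤ 1 := by rw [hc₁def]; exact min_le_right c 1
  obtain ⟨C, hCdef⟩ : ∃ C : ℝ, C = Real.log K := ⟨_, rfl⟩
  have hC0 : 0 ≤ C := by rw [hCdef]; exact Real.log_nonneg hK
  obtain ⟨ℓ₀, hℓ₀⟩ := Filter.eventually_atTop.1 (eventually_master (C + 2) (200 / c₁))
  refine ⟨Real.exp (Real.exp ℓ₀), ?_⟩
  intro R B a F hR1 hB0 hFd hFb hsum hLF hmaj x hxX hRx
  -- the scales `L = log x = e^ℓ`, `ℓ ≥ ℓ₀`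
  have hX1 : 1 < Real.exp (Real.exp ℓ₀) := by
    rw [← Real.exp_zero]; exact Real.exp_lt_exp.2 (Real.exp_pos ℓ₀)
  have hx1 : 1 < x := hX1.trans_le hxX
  have hx0 : 0 < x := by linarith
  set L : ℝ := Real.log x with hLdef
  set ℓ : ℝ := Real.log L with hℓdef
  have hL0 : 0 < L := Real.log_pos hx1
  have hℓ₀ℓ : ℓ₀ ≤ ℓ := by
    have h1 : Real.exp ℓ₀ ≤ L := by rw [hLdef, Real.le_log_iff_exp_le hx0]; exact hxX
    rw [hℓdef, Real.le_log_iff_exp_le hL0]; exact h1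
  obtain ⟨hℓ6, hℓC, hKℓ⟩ := hℓ₀ ℓ hℓ₀ℓ
  have hℓ2 : 2 ≤ ℓ := by linarith
  obtain ⟨-, -, -, hLℓ, hL7, -, -⟩ := RieszDiff.scales hx1 hLdef hℓdef hℓ2
  have hℓ0 : 0 < ℓ := by linarith
  have hℓ3 : 216 ≤ ℓ ^ 3 := by
    have := pow_le_pow_left₀ (by norm_num : (0:ℝ) ≤ 6) hℓ6 3; norm_num at this; exact this
  have hR0 : 0 ≤ R := by linarith
  have hR4 : R ≤ 4 * ℓ + 4 := hRx
  -- the height `T = exp(3ℓ³)`: `3ℓ³ ≤ log(T+4) ≤ 4ℓ³`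
  set T : ℝ := Real.exp (3 * ℓ ^ 3) with hTdef
  obtain ⟨hT3, -, -⟩ := RieszDiff.height_bounds hℓ2 hTdef
  have hT0 : 0 < T := by linarith
  have hlogT4 : 3 * ℓ ^ 3 ≤ Real.log (T + 4) := by
    rw [Real.le_log_iff_exp_le (by linarith), ← hTdef]; linarith
  have hlogT4' : Real.log (T + 4) ≤ 4 * ℓ ^ 3 := by
    rw [Real.log_le_iff_le_exp (by linarith)]
    have e : Real.exp (4 * ℓ ^ 3) = T * Real.exp (ℓ ^ 3) := by
      rw [hTdef, ← Real.exp_add]; ring_nf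
    have h9 : 9 ≤ Real.exp (ℓ ^ 3) := by linarith [Real.add_one_le_exp (ℓ ^ 3)]
    have := mul_le_mul_of_nonneg_left h9 hT0.le
    rw [e]; linarith
  have hlogT40 : 0 < Real.log (T + 4) := by linarith
  -- the abscissae `σ₀ = 1 + 1/L`, `σ₁ = 1 − δ`, `δ = c'/log(T+4) ∈ (0, 1/4]`
  obtain ⟨σ₀, hσ₀def⟩ : ∃ σ₀ : ℝ, σ₀ = 1 + 1 / L := ⟨_, rfl⟩
  have h1L : 0 < 1 / L := by positivity
  have h1L1 : 1 / L ≤ 1 / 4 := one_div_le_one_div_of_le (by norm_num) (by linarith)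
  have hσ₀1 : 1 < σ₀ := by rw [hσ₀def]; linarith
  have hσ₀2 : σ₀ ≤ 2 := by rw [hσ₀def]; linarith
  have hR1' : 0 < R + 1 := by linarith
  obtain ⟨c', hc'def⟩ : ∃ c' : ℝ, c' = c₁ / (2 * (R + 1)) := ⟨_, rfl⟩
  have hc'0 : 0 < c' := by rw [hc'def]; positivity
  have hc'c : c' < c / (R + 1) := by
    rw [hc'def, ← div_div]
    exact div_lt_div_of_pos_right (by linarith) hR1'
  have hc'4 : c' ≤ 1 / 4 := by
    rw [hc'def, div_le_iff₀ (by positivity)]; linarith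
  obtain ⟨δ, hδdef⟩ : ∃ δ : ℝ, δ = c' / Real.log (T + 4) := ⟨_, rfl⟩
  have hδ0 : 0 < δ := by rw [hδdef]; positivity
  have hδ4 : δ ≤ 1 / 4 := by
    rw [hδdef, div_le_iff₀ hlogT40]; linarith
  obtain ⟨σ₁, hσ₁def⟩ : ∃ σ₁ : ℝ, σ₁ = 1 - δ := ⟨_, rfl⟩
  have hσ₁₀ : σ₁ ≤ σ₀ := by linarith
  have hσ₁c : 1 - c' / Real.log (T + 4) ≤ σ₁ := by rw [hσ₁def, hδdef]
  -- the contour estimate at these parameters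
  have hcore := stub_apHolRieszBoundCore (c / (R + 1)) K R B a F x σ₀ σ₁ T c' hK hR0 hB0 hFd hFb
    (hsum σ₀ hσ₀1) hLF hx1.le hσ₀1 hc'0.le hc'c hT0 (by linarith) hσ₁₀ hσ₁c
  refine hcore.trans ?_
  -- the unit `V = x² B e^{−Rℓ − ℓ³}` and the exponential forms of the ingredients
  obtain ⟨V, hVdef⟩ : ∃ V : ℝ, V = x ^ 2 * B * Real.exp (-(R * ℓ) - ℓ ^ 3) := ⟨_, rfl⟩
  have hV0 : 0 ≤ V := by rw [hVdef]; positivity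
  have hx2σ₀ : x ^ (1 + σ₀) = x ^ 2 * Real.exp 1 := by
    rw [hσ₀def, show (1 : ℝ) + (1 + 1 / L) = 2 + 1 / L by ring, Real.rpow_add hx0, Real.rpow_two,
      Real.rpow_def_of_pos hx0, ← hLdef, mul_one_div_cancel hL0.ne']
  have hx2σ₁ : x ^ (1 + σ₁) = x ^ 2 * Real.exp (-(L * δ)) := by
    rw [hσ₁def, show (1 : ℝ) + (1 - δ) = 2 + -δ by ring, Real.rpow_add hx0, Real.rpow_two,
      Real.rpow_def_of_pos hx0, ← hLdef, mul_neg]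
  have hKlog0 : 0 < K * Real.log (T + 4) := mul_pos hK0 hlogT40
  obtain ⟨Λ, hΛdef⟩ : ∃ Λ : ℝ, Λ = Real.log (K * Real.log (T + 4)) := ⟨_, rfl⟩
  have hfacR : (K * Real.log (T + 4)) ^ R = Real.exp (Λ * R) := by
    rw [Real.rpow_def_of_pos hKlog0, ← hΛdef]
  have hΛle : Λ ≤ C + 2 + 3 * ℓ := by
    rw [hΛdef, hCdef]; exact log_factor_le hK (by linarith) (by linarith) hlogT4'
  have hTinv : 1 / T = Real.exp (-(3 * ℓ ^ 3)) := by rw [hTdef, Real.exp_neg, one_div]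
  have hT2 : 1 / T ^ 2 = Real.exp (-(6 * ℓ ^ 3)) := by
    rw [hTdef, ← Real.exp_nat_mul, one_div, ← Real.exp_neg]; congr 1; push_cast; ring
  have hLR : L ^ R = Real.exp (R * ℓ) := by rw [Real.rpow_def_of_pos hL0, ← hℓdef, mul_comm]
  -- the key inequalities and `Lδ ≥ 5ℓ³`
  obtain ⟨hk1, hk2⟩ := key hℓ6 hC0 hℓC hR0 hR4 hΛle
  have hLδ : 5 * ℓ ^ 3 ≤ L * δ := by
    have hprod : 2 * (R + 1) * Real.log (T + 4) ≤ 40 * ℓ ^ 4 := by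
      calc 2 * (R + 1) * Real.log (T + 4) ≤ (10 * ℓ) * (4 * ℓ ^ 3) :=
            mul_le_mul (by linarith) hlogT4' hlogT40.le (by positivity)
        _ = 40 * ℓ ^ 4 := by ring
    have h1 : c₁ / (40 * ℓ ^ 4) ≤ δ := by
      rw [hδdef, hc'def, div_div]
      exact div_le_div_of_nonneg_left hc₁0.le (by positivity) hprod
    have hL' : 200 / c₁ * ℓ ^ 7 ≤ L := by rw [hLℓ]; exact hKℓ
    calc 5 * ℓ ^ 3 = (200 / c₁ * ℓ ^ 7) * (c₁ / (40 * ℓ ^ 4)) := by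
          field_simp; ring
      _ ≤ L * δ := mul_le_mul hL' h1 (by positivity) hL0.le
  -- the majorant at `σ₀`
  have hS : ∑' n : ℕ, ‖LSeries.term a σ₀ n‖ ≤ B * Real.exp (R * ℓ) := by
    have h := hmaj σ₀ hσ₀1 hσ₀2
    have e : σ₀ - 1 = 1 / L := by rw [hσ₀def]; ring
    rw [e, Real.div_rpow zero_le_one hL0.le, Real.one_rpow, hLR, one_div, div_inv_eq_mul] at h
    exact h
  have hS0 : 0 ≤ ∑' n : ℕ, ‖LSeries.term a σ₀ n‖ := tsum_nonneg fun n ↦ norm_nonneg _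
  -- piece 1: the tails
  have s1 : x ^ (1 + σ₀) * (∑' n : ℕ, ‖LSeries.term a σ₀ n‖) / T ≤ V := by
    rw [div_eq_mul_one_div _ T, hTinv, hx2σ₀]
    calc x ^ 2 * Real.exp 1 * (∑' n : ℕ, ‖LSeries.term a σ₀ n‖) * Real.exp (-(3 * ℓ ^ 3))
        ≤ x ^ 2 * Real.exp 1 * (B * Real.exp (R * ℓ)) * Real.exp (-(3 * ℓ ^ 3)) :=
          mul_le_mul_of_nonneg_right (mul_le_mul_of_nonneg_left hS (by positivity))
            (Real.exp_pos _).le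
      _ = x ^ 2 * B * (Real.exp 1 * Real.exp (R * ℓ) * Real.exp (-(3 * ℓ ^ 3))) := by ring
      _ ≤ x ^ 2 * B * Real.exp (-(R * ℓ) - ℓ ^ 3) := by
          refine mul_le_mul_of_nonneg_left ?_ (by positivity)
          rw [← Real.exp_add, ← Real.exp_add, Real.exp_le_exp]
          linarith
      _ = V := hVdef.symm
  -- piece 2: the left side
  have s2 : x ^ (1 + σ₁) * (B * (K * Real.log (T + 4)) ^ R) ≤ V / 8 := by
    rw [hx2σ₁, hfacR]
    calc x ^ 2 * Real.exp (-(L * δ)) * (B * Real.exp (Λ * R))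
        = x ^ 2 * B * (Real.exp (-(L * δ)) * Real.exp (Λ * R)) := by ring
      _ ≤ x ^ 2 * B * (Real.exp (-(R * ℓ) - ℓ ^ 3) * Real.exp (-3)) := by
          refine mul_le_mul_of_nonneg_left ?_ (by positivity)
          rw [← Real.exp_add, ← Real.exp_add, Real.exp_le_exp]
          linarith
      _ ≤ x ^ 2 * B * (Real.exp (-(R * ℓ) - ℓ ^ 3) * (1 / 8)) := by
          refine mul_le_mul_of_nonneg_left (mul_le_mul_of_nonneg_left ?_ (Real.exp_pos _).le)
            (by positivity)
          rw [Real.exp_neg, one_div]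
          exact inv_anti₀ (by norm_num) (by linarith [RieszDiff.numerics.1])
      _ = V / 8 := by rw [hVdef]; ring
  -- piece 3: the horizontal sides
  have s3 : (σ₀ - σ₁) * (x ^ (1 + σ₀) * (B * (K * Real.log (T + 4)) ^ R) / T ^ 2) ≤ V := by
    rw [div_eq_mul_one_div _ (T ^ 2), hT2, hx2σ₀, hfacR]
    have hdiff1 : σ₀ - σ₁ ≤ 1 := by linarith
    calc (σ₀ - σ₁) * (x ^ 2 * Real.exp 1 * (B * Real.exp (Λ * R)) * Real.exp (-(6 * ℓ ^ 3)))
        ≤ 1 * (x ^ 2 * Real.exp 1 * (B * Real.exp (Λ * R)) * Real.exp (-(6 * ℓ ^ 3))) :=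
          mul_le_mul_of_nonneg_right hdiff1 (by positivity)
      _ = x ^ 2 * B * (Real.exp 1 * Real.exp (Λ * R) * Real.exp (-(6 * ℓ ^ 3))) := by ring
      _ ≤ x ^ 2 * B * Real.exp (-(R * ℓ) - ℓ ^ 3) := by
          refine mul_le_mul_of_nonneg_left ?_ (by positivity)
          rw [← Real.exp_add, ← Real.exp_add, Real.exp_le_exp]
          linarith
      _ = V := hVdef.symm
  -- `V` is the claimed bound
  have hVeq : V = x ^ 2 * L ^ (-R) * Real.exp (-ℓ ^ 3) * B := by
    rw [hVdef, Real.rpow_def_of_pos hL0, ← hℓdef,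
      show -(R * ℓ) - ℓ ^ 3 = ℓ * -R + -ℓ ^ 3 by ring, Real.exp_add]
    ring
  -- conclusion: `(1/2π)·(2V + 2V + 2V) ≤ V`
  have hπ : 1 / (2 * π) ≤ 1 / 6 :=
    div_le_div_of_nonneg_left (by norm_num) (by norm_num) (by linarith [Real.pi_gt_three])
  have s2' : 4 * π * (x ^ (1 + σ₁) * (B * (K * Real.log (T + 4)) ^ R)) ≤ 2 * V := by
    have h0 : 0 ≤ x ^ (1 + σ₁) * (B * (K * Real.log (T + 4)) ^ R) := by positivity
    calc 4 * π * (x ^ (1 + σ₁) * (B * (K * Real.log (T + 4)) ^ R)) ≤ 4 * 4 * (V / 8) :=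
          mul_le_mul (by linarith [Real.pi_lt_four]) s2 h0 (by norm_num)
      _ = 2 * V := by ring
  calc 1 / (2 * π) * (2 * (x ^ (1 + σ₀) * (∑' n : ℕ, ‖LSeries.term a σ₀ n‖) / T) +
        4 * π * (x ^ (1 + σ₁) * (B * (K * Real.log (T + 4)) ^ R)) +
        2 * ((σ₀ - σ₁) * (x ^ (1 + σ₀) * (B * (K * Real.log (T + 4)) ^ R) / T ^ 2)))
      ≤ 1 / (2 * π) * (6 * V) := by
        refine mul_le_mul_of_nonneg_left ?_ (by positivity)
        linarith [s1, s2', s3]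
    _ ≤ 1 / 6 * (6 * V) := mul_le_mul_of_nonneg_right hπ (by positivity)
    _ = V := by ring
    _ = x ^ 2 * L ^ (-R) * Real.exp (-ℓ ^ 3) * B := hVeq

end Summit.Parity.BatemanHorn.Cruxes.DiscMajorantLog.Sketch

end
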